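import Literature.AlgebraicGeometry.Motives.GaloisThickening
import Literature.AlgebraicGeometry.RelativeSpec.GeometricQuotientOfEtaleCover
import Mathlib.RingTheory.Etale.Field
import Mathlib.RingTheory.RingHom.Etale
import HarnessLib

/-!
# The projection `π_X : X ⊗_K L → X` of the Galois thickening is a geometric quotient by `Gal(L ∕ K)`
# (Mumford, *Abelian Varieties*, §7 Thm. p. 66; SGA 1, Exp. V, Prop. 1.8)

Topic `Literature/AlgebraicGeometry/Motives`, namespace `Literature.AlgebraicGeometry.Motives`.  THEOREMS ONLY; no definition,
no named fact, no instance, no notation, no `sorry`.  Sequel of ★ `Motives/GaloisThickening` (the thickening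
`R_L X = (X ⊗_K L → Spec L → Spec K)`, its Galois action `thickeningGalAction` and projection `thickeningπ`); socket GAL-2
of the P6a sub-line `Cruxes/HLiu418/Lines/F0_P6a_ModuliDatum.lean` ED. 2 (cell `hodgecm-mathlib`, desk F0P6a-plan (g0), census
`F0/P6/F0P6a-plan/ED2-CENSUS-P6a.v1.F0P6a-plan-g0.md` §4), statement VERBATIM from the desk's sketch
`sketch-ED2-thickening.v1.F0P6a-plan-g0.lean` 10b2b456ace7c7da :141.  HC_CM is proved only modulo the printed citations until
rung 0 closes; nothing here is about HC.

THE MATHEMATICS.  Let `L ∕ K` be a finite Galois extension with group `Γ = Gal(L ∕ K)` and `X` a `K`-scheme.  Then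
`π_X = pr₁ : X ×_K Spec L → X` is a GEOMETRIC QUOTIENT of `X ×_K Spec L` by `Γ` (acting through `1 × Spec σ⁻¹`) in Mumford's
sense (★ `ActionOver.IsGeometricQuotient`: (1) topological quotient, (2) `𝒪_X ⥲ (π_*𝒪)^Γ`): `π_X` is the base change of
`Spec L → Spec K`, hence AFFINE, ÉTALE (`L ∕ K` finite separable: Mathlib `Algebra.FormallyEtale.of_isSeparable`) and
SURJECTIVE, and `Γ` is TRANSITIVE ON ITS GEOMETRIC FIBRES — two `Ω`-points of `X ×_K Spec L` over the same `Ω`-point of `X`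
are pairs `(P, e₁)`, `(P, e₂)` with `K`-embeddings `eᵢ : L → Ω` (★ `thickeningPointsEquiv`), and `e₂ = e₁ ∘ σ` for some
`σ ∈ Γ` because `L ∕ K` is normal (Mathlib `AlgHom.restrictNormal'`); so the tree's recognition theorem for étale covers
★ `ActionOver.isGeometricQuotient_of_etale_of_transitive` ([SGA1] V Prop. 2.6, [MumfordAV1970] §7) applies, and the
predicate is transported from the action-over-`π_X` to the action-over-`Spec K` by ★ `ActionOver.isGeometricQuotient_overMap_iff`.
Affine-locally this is the classical statement `(A ⊗_K L)^Γ = A` ([MumfordAV1970] §7 Thm. p. 66; [SGA1] V Prop. 1.8: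
`X ×_K Spec L → X` is a finite étale Galois cover with group `Γ`).

MAIN STATEMENTS.  §1 `algebraEtale_of_isSeparable`, `etale_bcSpec`, `etale_thickeningπ_left`, `isAffineHom_thickeningπ_left`,
`surjective_thickeningπ_left`, `finite_algEquiv_of_finiteDimensional`; §2 `exists_algEquiv_comp_eq_of_normal` (`Aut(L ∕ K)` is
transitive on `Hom_K(L, Ω)` for `L ∕ K` normal); §3 `exists_map_aut_eq_of_map_thickeningπ_eq` (transitivity on `Ω`-points over
`K`), `exists_eq_comp_aut_of_comp_fst_eq` (the same for bare geometric points of `X ×_K Spec L`); §4 THE HEAD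
**`isGeometricQuotient_thickeningπ`**.

## References
* [MumfordAV1970] D. Mumford, *Abelian Varieties* (1970), §7, Theorem p. 66.
* [SGA1] A. Grothendieck, *SGA 1*, Exp. V, Prop. 1.8, Prop. 2.6.
* [GortzWedhorn2020] U. Görtz, T. Wedhorn, *Algebraic Geometry I* (2nd ed. 2020), (14.20).
-/

set_option autoImplicit false

noncomputable section

open CategoryTheory AlgebraicGeometry Limits

universe u

namespace Literature.AlgebraicGeometry.Motives

open Literature.AlgebraicGeometry.RelativeSpec
open Literature.AlgebraicGeometry.Motives.AbelianVariety (bcSpec)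

variable {K L : Type u} [Field K] [Field L] [Algebra K L]

/-! ## §1 `Spec L → Spec K` and its base change `π_X`: étale, affine, surjective -/

variable (K L) in
/-- A finite separable field extension is an étale algebra (formally étale by separability, Mathlib
`Algebra.FormallyEtale.of_isSeparable`; of finite presentation because finite over a field). [cite: SGA1, Exp. I Prop. 4.10 ∕ Exp. V Prop. 1.8] -/
theorem algebraEtale_of_isSeparable [FiniteDimensional K L] [Algebra.IsSeparable K L] : Algebra.Etale K L :=
  ⟨Algebra.FormallyEtale.of_isSeparable K L, Algebra.FinitePresentation.of_finiteType.mp inferInstance⟩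

variable (K L) in
/-- `Spec L → Spec K` is étale for `L ∕ K` finite separable. [cite: SGA1, Exp. I Prop. 4.10 ∕ Exp. V Prop. 1.8] -/
theorem etale_bcSpec [FiniteDimensional K L] [Algebra.IsSeparable K L] : Etale (bcSpec K L) :=
  (HasRingHomProperty.Spec_iff (P := @Etale)).mpr (RingHom.etale_algebraMap.mpr (algebraEtale_of_isSeparable K L))

/-- `π_X : X ×_K Spec L → X` is étale for `L ∕ K` finite separable (base change of `Spec L → Spec K`).
[cite: SGA1, Exp. V Prop. 1.8] -/
theorem etale_thickeningπ_left [FiniteDimensional K L] [Algebra.IsSeparable K L] (X : SchemeOver K) :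
    Etale (thickeningπ (L := L) X).left := by
  rw [thickeningπ_left]
  exact MorphismProperty.pullback_fst _ _ (etale_bcSpec K L)

/-- `π_X : X ×_K Spec L → X` is an affine morphism (base change of the affine `Spec L → Spec K`). [cite: GortzWedhorn2020, §(4.8)–(4.9)] -/
theorem isAffineHom_thickeningπ_left (X : SchemeOver K) : IsAffineHom (thickeningπ (L := L) X).left := by
  rw [thickeningπ_left]
  exact MorphismProperty.pullback_fst _ _ inferInstance

/-- `π_X : X ×_K Spec L → X` is surjective (base change of the surjective `Spec L → Spec K`). [cite: GortzWedhorn2020, §(4.8)–(4.9)] -/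
theorem surjective_thickeningπ_left (X : SchemeOver K) : Surjective (thickeningπ (L := L) X).left := by
  have hs : Surjective (bcSpec K L) := ⟨fun x => ⟨default, Subsingleton.elim _ _⟩⟩
  rw [thickeningπ_left]
  exact MorphismProperty.pullback_fst _ _ hs

/-! ## §2 `Aut(L ∕ K)` is transitive on the `K`-embeddings `L → Ω` when `L ∕ K` is normal -/

/-- For `L ∕ K` normal, any two `K`-embeddings `e₁ e₂ : L → Ω` into a field differ by an automorphism of `L ∕ K`:
`e₂ = e₁ ∘ σ` (restrict `e₂` to the normal extension `L` inside `Ω` viewed as an `L`-algebra through `e₁`: Mathlib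
`AlgHom.restrictNormal'`). [cite: StacksProject, Tag 0BME] -/
theorem exists_algEquiv_comp_eq_of_normal [Normal K L] {Ω : Type*} [Field Ω] [Algebra K Ω] (e₁ e₂ : L →ₐ[K] Ω) :
    ∃ σ : L ≃ₐ[K] L, e₁.comp (σ : L →ₐ[K] L) = e₂ := by
  letI : Algebra L Ω := (e₁ : L →+* Ω).toAlgebra
  haveI : IsScalarTower K L Ω := IsScalarTower.of_algebraMap_eq fun x => (e₁.commutes x).symm
  refine ⟨e₂.restrictNormal' L, AlgHom.ext fun x => ?_⟩
  have h := AlgHom.restrictNormal_commutes e₂ L x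
  rw [Algebra.algebraMap_self, RingHom.id_apply] at h
  exact h

/-! ## §3 Transitivity of `Gal(L ∕ K)` on the geometric fibres of `π_X` -/

/-- **Transitivity on `Ω`-points over `K`**: two `Ω`-points of `R_L X` with the same image under `π_X` differ by the Galois
action (they are `ℓ_{e₁} P` and `ℓ_{e₂} P` with `e₂ = e₁ ∘ τ`, and `τ⁻¹ · ℓ_{e₁} P = ℓ_{e₁ ∘ τ} P`, ★ `aut_thickeningLift`).
[cite: MumfordAV1970, §7 Thm. p. 66 (1)] -/
theorem exists_map_aut_eq_of_map_thickeningπ_eq [Normal K L] {Ω : Type u} [Field Ω] [Algebra K Ω] (X : SchemeOver K)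
    (P₁ P₂ : AlgPoints ((thickening K L).obj X) Ω)
    (h : AlgPoints.map (thickeningπ X) P₁ = AlgPoints.map (thickeningπ X) P₂) :
    ∃ σ : L ≃ₐ[K] L,
      AlgPoints.map (Over.homMk ((thickeningGalAction X).aut σ).hom ((thickeningGalAction X).aut_comp σ)) P₁ = P₂ := by
  obtain ⟨τ, hτ⟩ := exists_algEquiv_comp_eq_of_normal (AlgPoints.embOfPoint ((baseChange K L).obj X) P₁)
    (AlgPoints.embOfPoint ((baseChange K L).obj X) P₂)
  refine ⟨τ.symm, ?_⟩
  rw [← thickeningLift_embOfPoint_map_thickeningπ X P₁, map_aut_thickeningLift, AlgEquiv.symm_symm, hτ, h,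
    thickeningLift_embOfPoint_map_thickeningπ]

/-- **Transitivity on geometric points**, bare form: two morphisms `x₁ x₂ : Spec Ω → X ×_K Spec L` with
`x₁ ≫ pr₁ = x₂ ≫ pr₁` satisfy `x₂ = x₁ ≫ (1 × Spec σ⁻¹)` for some `σ ∈ Aut(L ∕ K)` (make `Ω` a `K`-algebra through
`x₁ ≫ pr₁ ≫ (X → Spec K)` and apply the previous theorem). [cite: MumfordAV1970, §7 Thm. p. 66 (1)] -/
theorem exists_eq_comp_aut_of_comp_fst_eq [Normal K L] (X : SchemeOver K) {Ω : Type u} [Field Ω]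
    (x₁ x₂ : Spec (.of Ω) ⟶ ((thickening K L).obj X).left)
    (h : x₁ ≫ (thickeningπ (L := L) X).left = x₂ ≫ (thickeningπ (L := L) X).left) :
    ∃ σ : L ≃ₐ[K] L, x₂ = x₁ ≫ ((thickeningGalAction X).aut σ).hom := by
  letI : Algebra K Ω := (Spec.preimage (x₁ ≫ (thickeningπ (L := L) X).left ≫ X.hom)).hom.toAlgebra
  have hK : Spec.map (CommRingCat.ofHom (algebraMap K Ω)) = x₁ ≫ (thickeningπ (L := L) X).left ≫ X.hom := by
    rw [RingHom.algebraMap_toAlgebra, CommRingCat.ofHom_hom, Spec.map_preimage]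
  have w₁ : x₁ ≫ ((thickening K L).obj X).hom = Spec.map (CommRingCat.ofHom (algebraMap K Ω)) := by
    rw [hK, Over.w (thickeningπ (L := L) X)]
  have w₂ : x₂ ≫ ((thickening K L).obj X).hom = Spec.map (CommRingCat.ofHom (algebraMap K Ω)) := by
    rw [hK, ← Over.w (thickeningπ (L := L) X), ← Category.assoc, ← Category.assoc, h]
  obtain ⟨σ, hσ⟩ := exists_map_aut_eq_of_map_thickeningπ_eq X (AlgPoints.mk x₁ w₁) (AlgPoints.mk x₂ w₂)
    (Over.OverMorphism.ext h)
  exact ⟨σ, (congrArg (fun P : AlgPoints ((thickening K L).obj X) Ω => P.left) hσ).symm⟩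

/-! ## §4 The head: `π_X` is a geometric quotient by `Gal(L ∕ K)` -/

/-- **ORGAN GAL-2.**  For `L ∕ K` finite Galois and any `K`-scheme `X`, the projection `π_X : X ×_K Spec L → X` is a geometric
quotient (★ `ActionOver.IsGeometricQuotient`: Mumford's (1) topological quotient and (2) `𝒪_X ⥲ (π_*𝒪)^{Gal}`) of the Galois
thickening `R_L X` by `Gal(L ∕ K)` acting through `σ ↦ 1 × Spec σ⁻¹` (★ `thickeningGalAction`).  Proof: `π_X` is affine,
étale and surjective (§1) and `Gal(L ∕ K)` is transitive on its geometric fibres (§3), so ★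
`ActionOver.isGeometricQuotient_of_etale_of_transitive` applies; ★ `ActionOver.isGeometricQuotient_overMap_iff` moves the
predicate from the action viewed over `π_X` to the action over `Spec K`.  Statement = the desk's socket GAL-2 verbatim.
[cite: MumfordAV1970, §7 Thm. p. 66] [cite: SGA1, Exp. V Prop. 1.8] -/
theorem isGeometricQuotient_thickeningπ [FiniteDimensional K L] [IsGalois K L] (X : SchemeOver K) :
    (thickeningGalAction (L := L) X).IsGeometricQuotient (thickeningπ (L := L) X).left := by
  rw [← (thickeningGalAction (L := L) X).isGeometricQuotient_overMap_iff (thickeningπ (L := L) X).left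
    (thickeningGalAction_comp_π X)]
  haveI := etale_thickeningπ_left (L := L) X
  haveI := isAffineHom_thickeningπ_left (L := L) X
  haveI := surjective_thickeningπ_left (L := L) X
  exact ActionOver.isGeometricQuotient_of_etale_of_transitive _ fun _Ω _ _ x₁ x₂ hx =>
    exists_eq_comp_aut_of_comp_fst_eq X x₁ x₂ hx

end Literature.AlgebraicGeometry.Motives

end
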